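import Summits.QuantumFields.YangMills.Theses.UnitScaleTilt
import Literature.MathematicalPhysics.QuantumFieldTheory.Balaban1983to89.B10Eq47Volume

/-!
# Route `UnitScaleTilt` — crux K2 `HistoryTail` (stmt-QuantumFields-18916): THE LARGE-FIELD BUDGET ARITHMETIC (G-B10-02) of the
# per-plaquette schema — gain `¼p(g)²` versus a collar cost `κ(1 + log g⁻¹)^a`, `a < 2p₀` (support file; sub-lemma S6 of the split card)

Fleet lead `ym-ust-18916-p1` (gen 0); split card `CARD-18916-K2-split.md` (evidence #12 on the item), sub-lemma **S6**.  In mechanism A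
of the route owner's K2 memo (§3 A) the Gibbs mass of ONE large block-averaged plaquette at distance `i` from the unit scale is bounded by
the printed small factor `exp(−¼p(g_i)²)` of [Balaban1985UV3] (71) times the COST of the collars the large plaquette forces at every
later scale, `exp(O(1)·(1 + log g_i⁻¹)^{2+3r₀})` (collar radius `R(g) = R₁(1 + log g⁻¹)^{r₀}` of (39), `O(log g⁻¹)` per collar block:
the cell's recorded objection G-B10-02), and PP's right-hand side allows `C·β_i^A·exp(−c·p(g_i)²)`.  Since `p(g)² = b₀²(1 + log g⁻¹)^{2p₀}`
(`B10Eq47Volume.pFun_sq`), the budget closes exactly when the cost exponent is `< 2p₀` — for the collar cost, `p₀ > 1 + 3r₀/2`, which the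
route's `∃ p₀ > 2` lets the line choose.

THIS FILE proves the budget as pure real analysis (**`largeFieldBudget`**): for `b₀ > 0`, `κ ≥ 0`, `0 ≤ a < 2p₀` there are `C ≥ 0` and
`c = ⅛` with `exp(−¼p(g)² + κ(1 + log g⁻¹)^a) ≤ C·exp(−c·p(g)²)` for every `0 < g ≤ 1` — the cost is absorbed into half the gain above
the threshold `u^{2p₀−a} ≥ 8κ/b₀²` (`u = 1 + log g⁻¹ ≥ 1`) and into the constant `C = exp(κ·T^{a/(2p₀−a)})`, `T = max 1 (8κ/b₀²)`, below
it; and the two packaged forms the composition uses (`largeFieldBudget_pFun`, with the threshold made explicit, and the corollary for the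
collar exponent `a = 2 + 3r₀`, `largeFieldBudget_collar`).

WHAT THIS IS NOT: no estimate of Bałaban's is used or proved; the collar-cost SHAPE `κ(1 + log g⁻¹)^{2+3r₀}` is the memo's reading of
(39)/(67)–(71), to be produced by sub-lemmas S3/S5 of the card (not here).  Nothing uses (α).
-/

noncomputable section

open Literature.MathematicalPhysics.QuantumFieldTheory.Balaban1983to89
open Literature.MathematicalPhysics.QuantumFieldTheory.Balaban1983to89.B10Eq47Volume (pFun_sq pFun_pos)

namespace Summit.QuantumFields.YangMills.Theorems.HistoryTailBudget

/-- **COST ABSORPTION**: for `b₀ > 0`, `κ ≥ 0`, `0 ≤ a < b` and every `u ≥ 1`,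
`κ·u^a ≤ ⅛·b₀²·u^b + κ·T^{a/(b−a)}` with `T = max 1 (8κ/b₀²)` (above the threshold `u^{b−a} ≥ 8κ/b₀²` the cost is half of `¼b₀²u^b`;
below it `u ≤ T^{1/(b−a)}`). [folklore] -/
theorem cost_le (b₀ κ a b : ℝ) (hb₀ : 0 < b₀) (hκ : 0 ≤ κ) (ha : 0 ≤ a) (hab : a < b) {u : ℝ} (hu : 1 ≤ u) :
    κ * u ^ a ≤ b₀ ^ 2 / 8 * u ^ b + κ * (max 1 (8 * κ / b₀ ^ 2)) ^ (a / (b - a)) := by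
  have hu0 : 0 < u := by linarith
  have hba : 0 < b - a := by linarith
  set T : ℝ := max 1 (8 * κ / b₀ ^ 2) with hT
  have hT1 : 1 ≤ T := le_max_left _ _
  have hT0 : 0 < T := by linarith
  have hsplit : u ^ b = u ^ a * u ^ (b - a) := by
    rw [← Real.rpow_add hu0]; ring_nf
  have hDnonneg : 0 ≤ κ * T ^ (a / (b - a)) := mul_nonneg hκ (Real.rpow_nonneg hT0.le _)
  have hua0 : 0 ≤ u ^ a := Real.rpow_nonneg hu0.le _
  by_cases hcase : 8 * κ / b₀ ^ 2 ≤ u ^ (b - a)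
  · -- above the threshold: `κ u^a ≤ ⅛ b₀² u^a u^{b−a}`
    have h1 : κ ≤ b₀ ^ 2 / 8 * u ^ (b - a) := by
      have hb2 : 0 < b₀ ^ 2 := by positivity
      rw [div_le_iff₀ hb2] at hcase
      linarith
    calc κ * u ^ a ≤ (b₀ ^ 2 / 8 * u ^ (b - a)) * u ^ a := mul_le_mul_of_nonneg_right h1 hua0
      _ = b₀ ^ 2 / 8 * u ^ b := by rw [hsplit]; ring
      _ ≤ b₀ ^ 2 / 8 * u ^ b + κ * T ^ (a / (b - a)) := le_add_of_nonneg_right hDnonneg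
  · -- below the threshold: `u ≤ T^{1/(b−a)}`, so `u^a ≤ T^{a/(b−a)}`
    rw [not_le] at hcase
    have hule : u ^ (b - a) ≤ T := hcase.le.trans (le_max_right _ _)
    have hu_le : u ≤ T ^ (1 / (b - a)) := by
      have := Real.rpow_le_rpow (Real.rpow_nonneg hu0.le _) hule (le_of_lt (one_div_pos.mpr hba))
      rwa [← Real.rpow_mul hu0.le, mul_one_div_cancel hba.ne', Real.rpow_one] at this
    have hua : u ^ a ≤ T ^ (a / (b - a)) := by
      calc u ^ a ≤ (T ^ (1 / (b - a))) ^ a := Real.rpow_le_rpow hu0.le hu_le ha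
        _ = T ^ (a / (b - a)) := by rw [← Real.rpow_mul hT0.le]; ring_nf
    have hub0 : 0 ≤ b₀ ^ 2 / 8 * u ^ b := by positivity
    calc κ * u ^ a ≤ κ * T ^ (a / (b - a)) := mul_le_mul_of_nonneg_left hua hκ
      _ ≤ b₀ ^ 2 / 8 * u ^ b + κ * T ^ (a / (b - a)) := le_add_of_nonneg_left hub0

/-- **THE LARGE-FIELD BUDGET (G-B10-02) IN BAŁABAN'S VARIABLE `g`**: for `b₀ > 0`, `κ ≥ 0`, `0 ≤ a < 2p₀` there is `C ≥ 0` such that for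
every coupling `0 < g ≤ 1`, `exp(−¼p(g)² + κ(1 + log g⁻¹)^a) ≤ C·exp(−⅛p(g)²)`, `p = B10.pFun b₀ p₀` ((7) p.257).  The printed gain
`exp(−¼p(g)²)` per large plaquette is [Balaban1985UV3] (71); the inequality itself is elementary. [cite: Balaban1985UV3, (7) p.257 and (71) p.273] -/
theorem largeFieldBudget_pFun (b₀ p₀ κ a : ℝ) (hb₀ : 0 < b₀) (hκ : 0 ≤ κ) (ha : 0 ≤ a) (hap : a < 2 * p₀) :
    ∀ g : ℝ, 0 < g → g ≤ 1 →
      Real.exp (-(B10.pFun b₀ p₀ g ^ 2 / 4) + κ * (1 + Real.log g⁻¹) ^ a) ≤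
        Real.exp (κ * (max 1 (8 * κ / b₀ ^ 2)) ^ (a / (2 * p₀ - a))) * Real.exp (-(B10.pFun b₀ p₀ g ^ 2 / 8)) := by
  intro g hg hg1
  have hu : 1 ≤ 1 + Real.log g⁻¹ := by have := B10.log_inv_nonneg_of_le_one hg hg1; linarith
  have hcost := cost_le b₀ κ a (2 * p₀) hb₀ hκ ha hap hu
  rw [← Real.exp_add]
  refine Real.exp_le_exp.mpr ?_
  rw [pFun_sq b₀ p₀ g hg hg1]
  nlinarith [hcost]

/-- **THE LARGE-FIELD BUDGET, PACKAGED** as the split card's S6: `∃ C ≥ 0, c > 0, ∀ 0 < g ≤ 1, exp(−¼p(g)² + κ(1 + log g⁻¹)^a) ≤ C·exp(−c·p(g)²)`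
(`c = ⅛`). [cite: Balaban1985UV3, (7) p.257 and (71) p.273] -/
theorem largeFieldBudget (b₀ p₀ κ a : ℝ) (hb₀ : 0 < b₀) (hκ : 0 ≤ κ) (ha : 0 ≤ a) (hap : a < 2 * p₀) :
    ∃ C c : ℝ, 0 ≤ C ∧ 0 < c ∧ ∀ g : ℝ, 0 < g → g ≤ 1 →
      Real.exp (-(B10.pFun b₀ p₀ g ^ 2 / 4) + κ * (1 + Real.log g⁻¹) ^ a) ≤ C * Real.exp (-(c * B10.pFun b₀ p₀ g ^ 2)) := by
  refine ⟨Real.exp (κ * (max 1 (8 * κ / b₀ ^ 2)) ^ (a / (2 * p₀ - a))), 1 / 8, (Real.exp_pos _).le, by norm_num,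
    fun g hg hg1 => ?_⟩
  have h := largeFieldBudget_pFun b₀ p₀ κ a hb₀ hκ ha hap g hg hg1
  rwa [show -(1 / 8 * B10.pFun b₀ p₀ g ^ 2) = -(B10.pFun b₀ p₀ g ^ 2 / 8) by ring]

/-- **THE COLLAR CASE** (exponent `a = 2 + 3r₀`): for `r₀ ≥ 0` and `p₀ > 1 + 3r₀/2` — the proviso G-B10-02 of the cell's reading of
[Balaban1985UV3] (39)/(67)–(71), honoured in the Balaban3D lane by `p₀ := 2r₀ + 1` (`Primitives.prov_r₀p₀`) — the collar cost
`κ(1 + log g⁻¹)^{2+3r₀}` is absorbed: `∃ C ≥ 0, c > 0, ∀ 0 < g ≤ 1, exp(−¼p(g)² + κ(1 + log g⁻¹)^{2+3r₀}) ≤ C·exp(−c·p(g)²)`.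
[cite: Balaban1985UV3, (39) p.266 and (71) p.273] -/
theorem largeFieldBudget_collar (b₀ p₀ κ r₀ : ℝ) (hb₀ : 0 < b₀) (hκ : 0 ≤ κ) (hr₀ : 0 ≤ r₀) (hp₀ : 1 + 3 * r₀ / 2 < p₀) :
    ∃ C c : ℝ, 0 ≤ C ∧ 0 < c ∧ ∀ g : ℝ, 0 < g → g ≤ 1 →
      Real.exp (-(B10.pFun b₀ p₀ g ^ 2 / 4) + κ * (1 + Real.log g⁻¹) ^ (2 + 3 * r₀)) ≤
        C * Real.exp (-(c * B10.pFun b₀ p₀ g ^ 2)) :=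
  largeFieldBudget b₀ p₀ κ (2 + 3 * r₀) hb₀ hκ (by linarith) (by linarith)

end Summit.QuantumFields.YangMills.Theorems.HistoryTailBudget

end
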